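import Summits.QuantumFields.BalabanUV.T4Continuum.Spine.NE7.QLaCensusTorusMultiplicity

/-!
# Spine/NE7/QLaLargeEntries — (QL-a) WHEN NODE S IS SILENT ON THE ENTRIES THAT ARE LARGE FOR THEIR AGE (reading (b) of the
# ledger: domain-indexed terms carrying the printed decay `e^{−κ d_j(X)}`): the contracting bound for the small-for-age entries,
# the weight-carrying TRIVIAL bound for all entries, and a `δ`-TILTED census ⟹ `Spine.NE7.QLa` with the SAME ratio `θ²Λ`

Cell `pub-balaban-gaps` (YM blitz Y1, track G2, seat `ne7`, generation 15); text of record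
`run/shared/lean/pub/pub-balaban-gaps/ne/NE7.md` (census R84 of this generation).  Fifty-eighth `Spine/NE7/` file; 0 `def`, 0 sorry;
[folklore] finite-sum bookkeeping over `Spine.NE7.QLa` (file 2), `T4RecentScale.Multiplicity` and file 44's printed-format census.

WHY.  File 57 (`QLaYoungEntries`, R83) records that NODE S's silence on the youngest `n₁` ages costs a `K`-independent constant.
Its hypothesis is a UNIFORM cutoff `n₁`; but the level-free domain condition of files 55∕56 is `|Λ_X|·Dm_X ≤ min(τ⋆, τ⋆₂)` with
`Dm_X = C·L^{−age}` for an insert of print's kind ([Balaban1989LargeFieldI] (1.100) p. 196), i.e. a SIZE-DEPENDENT cutoff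
`age ≥ log_L(C′·|X|∕τ⋆)` (census §7quindecies: «silent on the youngest ≈ 18 + log₃(C·|X|) levels»).  Under reading (a) of the ledger
(component-indexed R-quotients, [Balaban1989LargeFieldI] (0.3) p. 176) the printed size cap (F-cap) («contained in a cube of the size
100MR_k», p. 177 (i)) makes the cutoff uniform and file 57 applies as stated.  Under reading (b) (domain-indexed terms of the
exponentiated form (0.5)–(0.6) with the printed decay `exp(−κ d_k(X))` of [Balaban1989LargeFieldII] (1.100) p. 390, domains of ANY
size) there is no cap — THIS FILE records that the size dependence costs, again, only a constant: the entries that are LARGE FOR THEIR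
AGE (`sz X > S(age)`) are paid for by TILTING the census.  Precisely (`qla_of_defect_smallForAge`): if every entry obeys the
weight-carrying trivial bound `|c_t(X) − c_0(X)| ≤ 4|t|·wt X` (a term of size `wt X` whose rider has range `≤ 2`), the entries with
`sz X ≤ S(K − sc X)` obey the contracting bound `|c_t − c_0| ≤ 2|t|·Cd·wt X·(θ^{K − sc X})²`, the weights satisfy the census
`Multiplicity wf sc wt Cw vol Λ K` AND the `δ`-tilted census `Multiplicity wf sc (wt·e^{δ·sz}) Cδ vol Λ K`, and the threshold is
super-geometric in the sense `e^{−δ·S(n)} ≤ B·(θ²)ⁿ` (`n ≤ K`), then `Spine.NE7.QLa wf sc ct c0 K vol (2l₀CdCw + 4l₀CδB) (θ²Λ)`.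
§2 makes `B` EXPLICIT for thresholds of print's kind `S(n) = s₀·rⁿ` (`r = L`, `s₀ = τ⋆∕C′`): `e^{−a·rⁿ} ≤ (m!∕a^m)·(θ²)ⁿ` as soon as
`(θ²)⁻¹ ≤ r^m` (`exp_neg_mul_pow_le_geometric`, from Mathlib's `x^m∕m! ≤ eˣ`; such an `m` exists for `r > 1`, `exists_pow_ge_inv_sq`) — a
constant independent of `K` AND of the entry, astronomically large with generation 8's `τ⋆ ≈ 2·10⁻⁹` (`a = δ·s₀`), honest either
way.  §3 discharges the tilted census in the PRINTED format on the cell's tori from file 44: weights `≤ E₀·e^{−κ·d_j(X)}` with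
`κ ≥ κ₀(4·2^d, 2d) + δ` have tilted weights `≤ E₀·e^{−(κ−δ)·d_j(X)}`, so `multiplicity_of_torusTreeDecay_sites` applies with the
same constant (`multiplicity_tilted_of_torusTreeDecay_sites`) — the room `δ` exists iff the printed decay rate `κ` of (1.100) exceeds
the census threshold `κ₀(4·2^d, 2d)` STRICTLY (then any `δ ∈ (0, κ − κ₀]`; the constant grows like `δ^{−m}`); whether it does is a
numerical fact about print's constants, NOT settled here.  §4 is the END corollary on the tori with `sz = d_j` (`qla_of_defect_smallForAge_torus`).

HONEST FRAMING.  Finite-sum algebra and two real-analysis one-liners; the hypotheses are SHAPES (which entries satisfy the contracting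
bound; the trivial bound's weight-carrying form; the decay format) to be discharged by NODE 00 Stage 5 on Bałaban's objects — which
reading ((a) or (b)) the object node's ledger takes is ITS call (census §4undecies); nothing of Bałaban's asserted beyond print;
(QL-a) NOT IN PRINT ([Balaban1989LargeFieldII] p. 356); NE7 NOT proved; spine 0∕9; one fixed finite T⁴ — NOT ℝ⁴, NOT infinite
volume, NOT a mass gap, NOT Clay.  No classification word moves (R10).
-/

noncomputable section

open Finset
open scoped BigOperators Nat

namespace Summit.QuantumFields.BalabanUV.T4Continuum.Spine.NE7

open Literature.MathematicalPhysics.QuantumFieldTheory.Balaban1983to89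
open Literature.MathematicalPhysics.QuantumFieldTheory.Balaban1983to89.TreeLengthTorus (TFaceConnected torusTreeLen)
open Literature.MathematicalPhysics.QuantumFieldTheory.Balaban1983to89.B12TreeDecay (kappa₀ K₀ K₀_pos)
open Literature.MathematicalPhysics.QuantumFieldTheory.Balaban1983to89.T4RecentScale (Multiplicity)

variable {D : Type*}

/-! ## §1 Large-for-their-age entries are paid for by tilting the census -/

/-- TILTING: on a family of entries with `S ≤ sz X`, the plain weights are at most `e^{−δS}` times the `δ`-tilted weights
`wt X·e^{δ·sz X}` (`δ ≥ 0`, `wt ≥ 0`). [folklore] -/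
theorem sum_large_le_exp_mul_tilted {s : Finset D} {wt sz : D → ℝ} {δ S : ℝ} (hδ : 0 ≤ δ) (hwt : ∀ X ∈ s, 0 ≤ wt X)
    (hlarge : ∀ X ∈ s, S ≤ sz X) :
    ∑ X ∈ s, wt X ≤ Real.exp (-(δ * S)) * ∑ X ∈ s, wt X * Real.exp (δ * sz X) := by
  rw [mul_sum]
  refine sum_le_sum fun X hX => ?_
  have h1 : (1 : ℝ) ≤ Real.exp (-(δ * S)) * Real.exp (δ * sz X) := by
    rw [← Real.exp_add]
    exact Real.one_le_exp (by nlinarith [hlarge X hX])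
  calc wt X = wt X * 1 := (mul_one _).symm
    _ ≤ wt X * (Real.exp (-(δ * S)) * Real.exp (δ * sz X)) := mul_le_mul_of_nonneg_left h1 (hwt X hX)
    _ = Real.exp (-(δ * S)) * (wt X * Real.exp (δ * sz X)) := by ring

/-- ONE SLICE WITH THE SMALL ∕ LARGE SPLIT: on the scale-`j` slice (age `n = K − j`), the entries with `sz ≤ S n` obey the contracting
bound and are summed by the census; the entries with `sz > S n` obey only the weight-carrying trivial bound `4|t|·wt` and are summed by
the `δ`-TILTED census at the price `e^{−δ S n} ≤ B·(θ²)ⁿ`.  Total `≤ vol·(2l₀CdCw + 4l₀CδB)·(θ²Λ)ⁿ`. [folklore] -/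
theorem slice_le_of_defect_smallForAge {wf : Finset D} {sc : D → ℕ} {wt sz ct c0 : D → ℝ} {K j : ℕ}
    {l₀ Cd θ t Cw Cδ vol Λ δ B : ℝ} (S : ℕ → ℝ)
    (ht : |t| ≤ l₀) (hCd : 0 ≤ Cd) (hwt : ∀ X ∈ wf, 0 ≤ wt X) (hδ : 0 ≤ δ) (hvol : 0 ≤ vol) (hΛ : 0 ≤ Λ) (hCδ : 0 ≤ Cδ)
    (hj : j ≤ K)
    (htriv : ∀ X ∈ wf, sc X = j → |ct X - c0 X| ≤ 4 * |t| * wt X)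
    (hdef : ∀ X ∈ wf, sc X = j → sz X ≤ S (K - j) → |ct X - c0 X| ≤ 2 * (|t| * (Cd * wt X * (θ ^ (K - j)) ^ 2)))
    (hM : Multiplicity wf sc wt Cw vol Λ K) (hMδ : Multiplicity wf sc (fun X => wt X * Real.exp (δ * sz X)) Cδ vol Λ K)
    (hS : Real.exp (-(δ * S (K - j))) ≤ B * (θ ^ 2) ^ (K - j)) :
    ∑ X ∈ wf with sc X = j, |ct X - c0 X| ≤ vol * ((2 * l₀ * Cd * Cw + 4 * l₀ * Cδ * B) * (θ ^ 2 * Λ) ^ (K - j)) := by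
  classical
  have hl₀ : 0 ≤ l₀ := (abs_nonneg t).trans ht
  have hθ2 : 0 ≤ (θ ^ 2) ^ (K - j) := pow_nonneg (sq_nonneg θ) _
  have hΛn : 0 ≤ Λ ^ (K - j) := pow_nonneg hΛ _
  have hcoef : 0 ≤ 2 * l₀ * Cd * (θ ^ 2) ^ (K - j) := by positivity
  have hB : 0 ≤ B * (θ ^ 2) ^ (K - j) := (Real.exp_nonneg _).trans hS
  set sl : Finset D := wf.filter fun X => sc X = j with hsl
  have hsl_wt : ∀ X ∈ sl, 0 ≤ wt X := fun X hX => hwt X (mem_filter.mp hX).1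
  -- the census sums of the slice
  have hMj : ∑ X ∈ sl, wt X ≤ Cw * vol * Λ ^ (K - j) := hM j hj
  have hMδj : ∑ X ∈ sl, wt X * Real.exp (δ * sz X) ≤ Cδ * vol * Λ ^ (K - j) := hMδ j hj
  -- split the slice into small and large entries
  rw [← sum_filter_add_sum_filter_not sl (fun X => sz X ≤ S (K - j))]
  -- small part: contracting bound + census
  have hsmall : ∑ X ∈ sl with sz X ≤ S (K - j), |ct X - c0 X| ≤ 2 * l₀ * Cd * (θ ^ 2) ^ (K - j) * (Cw * vol * Λ ^ (K - j)) := by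
    calc ∑ X ∈ sl with sz X ≤ S (K - j), |ct X - c0 X|
        ≤ ∑ X ∈ sl with sz X ≤ S (K - j), 2 * l₀ * Cd * (θ ^ 2) ^ (K - j) * wt X := sum_le_sum fun X hX => by
            obtain ⟨hXsl, hXsz⟩ := mem_filter.mp hX
            obtain ⟨hXw, hXj⟩ := mem_filter.mp hXsl
            have h := hdef X hXw hXj hXsz
            rw [← pow_mul, mul_comm (K - j) 2, pow_mul] at h
            have hs : 0 ≤ Cd * wt X * (θ ^ 2) ^ (K - j) := mul_nonneg (mul_nonneg hCd (hwt X hXw)) hθ2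
            calc |ct X - c0 X| ≤ 2 * (|t| * (Cd * wt X * (θ ^ 2) ^ (K - j))) := h
              _ ≤ 2 * (l₀ * (Cd * wt X * (θ ^ 2) ^ (K - j))) :=
                  mul_le_mul_of_nonneg_left (mul_le_mul_of_nonneg_right ht hs) zero_le_two
              _ = 2 * l₀ * Cd * (θ ^ 2) ^ (K - j) * wt X := by ring
      _ = 2 * l₀ * Cd * (θ ^ 2) ^ (K - j) * ∑ X ∈ sl with sz X ≤ S (K - j), wt X := (mul_sum _ _ _).symm
      _ ≤ 2 * l₀ * Cd * (θ ^ 2) ^ (K - j) * ∑ X ∈ sl, wt X :=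
          mul_le_mul_of_nonneg_left
            (sum_le_sum_of_subset_of_nonneg (filter_subset _ _) fun X hX _ => hsl_wt X hX) hcoef
      _ ≤ 2 * l₀ * Cd * (θ ^ 2) ^ (K - j) * (Cw * vol * Λ ^ (K - j)) := mul_le_mul_of_nonneg_left hMj hcoef
  -- large part: weight-carrying trivial bound + tilted census
  have hlarge : ∑ X ∈ sl with ¬ sz X ≤ S (K - j), |ct X - c0 X|
      ≤ 4 * l₀ * (B * (θ ^ 2) ^ (K - j) * (Cδ * vol * Λ ^ (K - j))) := by
    have h1 : ∑ X ∈ sl with ¬ sz X ≤ S (K - j), |ct X - c0 X| ≤ 4 * l₀ * ∑ X ∈ sl with ¬ sz X ≤ S (K - j), wt X := by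
      rw [mul_sum]
      refine sum_le_sum fun X hX => ?_
      obtain ⟨hXsl, -⟩ := mem_filter.mp hX
      obtain ⟨hXw, hXj⟩ := mem_filter.mp hXsl
      calc |ct X - c0 X| ≤ 4 * |t| * wt X := htriv X hXw hXj
        _ ≤ 4 * l₀ * wt X := mul_le_mul_of_nonneg_right (by linarith) (hwt X hXw)
    have h2 : ∑ X ∈ sl with ¬ sz X ≤ S (K - j), wt X
        ≤ Real.exp (-(δ * S (K - j))) * ∑ X ∈ sl with ¬ sz X ≤ S (K - j), wt X * Real.exp (δ * sz X) :=
      sum_large_le_exp_mul_tilted hδ (fun X hX => hsl_wt X (mem_filter.mp hX).1)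
        fun X hX => (lt_of_not_ge (mem_filter.mp hX).2).le
    have h3 : ∑ X ∈ sl with ¬ sz X ≤ S (K - j), wt X * Real.exp (δ * sz X) ≤ Cδ * vol * Λ ^ (K - j) :=
      (sum_le_sum_of_subset_of_nonneg (filter_subset _ _)
        fun X hX _ => mul_nonneg (hsl_wt X hX) (Real.exp_nonneg _)).trans hMδj
    calc ∑ X ∈ sl with ¬ sz X ≤ S (K - j), |ct X - c0 X|
        ≤ 4 * l₀ * ∑ X ∈ sl with ¬ sz X ≤ S (K - j), wt X := h1
      _ ≤ 4 * l₀ * (Real.exp (-(δ * S (K - j))) * (Cδ * vol * Λ ^ (K - j))) :=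
          mul_le_mul_of_nonneg_left (h2.trans (mul_le_mul_of_nonneg_left h3 (Real.exp_nonneg _))) (by positivity)
      _ ≤ 4 * l₀ * (B * (θ ^ 2) ^ (K - j) * (Cδ * vol * Λ ^ (K - j))) :=
          mul_le_mul_of_nonneg_left (mul_le_mul_of_nonneg_right hS (by positivity)) (by positivity)
  calc ∑ X ∈ sl with sz X ≤ S (K - j), |ct X - c0 X| + ∑ X ∈ sl with ¬ sz X ≤ S (K - j), |ct X - c0 X|
      ≤ 2 * l₀ * Cd * (θ ^ 2) ^ (K - j) * (Cw * vol * Λ ^ (K - j))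
          + 4 * l₀ * (B * (θ ^ 2) ^ (K - j) * (Cδ * vol * Λ ^ (K - j))) := add_le_add hsmall hlarge
    _ = vol * ((2 * l₀ * Cd * Cw + 4 * l₀ * Cδ * B) * (θ ^ 2 * Λ) ^ (K - j)) := by rw [mul_pow]; ring

/-- **(QL-a) WHEN NODE S IS SILENT ON THE LARGE-FOR-THEIR-AGE ENTRIES.**  A finite ledger `wf` with scales `sc ≤ K`, sizes `sz`,
weights `wt ≥ 0`; per entry the weight-carrying TRIVIAL bound `|c_t − c_0| ≤ 4|t|·wt` and, for the entries with
`sz X ≤ S(K − sc X)`, the CONTRACTING bound `|c_t − c_0| ≤ 2|t|·Cd·wt·(θ^{K − sc})²`; the census `Multiplicity wf sc wt Cw vol Λ K`,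
the `δ`-TILTED census `Multiplicity wf sc (wt·e^{δ·sz}) Cδ vol Λ K` (`δ ≥ 0`), and a threshold with `e^{−δ·S(n)} ≤ B·(θ²)ⁿ` for
`n ≤ K`.  Then for every `|t| ≤ l₀`: `Spine.NE7.QLa wf sc ct c0 K vol (2l₀CdCw + 4l₀CδB) (θ²·Λ)` — the SAME ratio as file 5's
`qla_of_defect`, a size constant independent of `K` and of the entries. [folklore] -/
theorem qla_of_defect_smallForAge {wf : Finset D} {sc : D → ℕ} {wt sz ct c0 : D → ℝ} {K : ℕ}
    {l₀ Cd θ t Cw Cδ vol Λ δ B : ℝ} (S : ℕ → ℝ)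
    (ht : |t| ≤ l₀) (hCd : 0 ≤ Cd) (hwt : ∀ X ∈ wf, 0 ≤ wt X) (hδ : 0 ≤ δ) (hvol : 0 ≤ vol) (hΛ : 0 ≤ Λ) (hCδ : 0 ≤ Cδ)
    (htriv : ∀ X ∈ wf, |ct X - c0 X| ≤ 4 * |t| * wt X)
    (hdef : ∀ X ∈ wf, sz X ≤ S (K - sc X) → |ct X - c0 X| ≤ 2 * (|t| * (Cd * wt X * (θ ^ (K - sc X)) ^ 2)))
    (hM : Multiplicity wf sc wt Cw vol Λ K) (hMδ : Multiplicity wf sc (fun X => wt X * Real.exp (δ * sz X)) Cδ vol Λ K)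
    (hS : ∀ n ≤ K, Real.exp (-(δ * S n)) ≤ B * (θ ^ 2) ^ n) :
    QLa wf sc ct c0 K vol (2 * l₀ * Cd * Cw + 4 * l₀ * Cδ * B) (θ ^ 2 * Λ) := by
  intro j hj
  refine slice_le_of_defect_smallForAge S ht hCd hwt hδ hvol hΛ hCδ hj (fun X hX _ => htriv X hX)
    (fun X hX hXj hsz => ?_) hM hMδ (hS _ (Nat.sub_le K j))
  have h := hdef X hX (by rw [hXj]; exact hsz)
  rwa [hXj] at h

/-! ## §2 Thresholds of print's kind: super-exponential beats geometric, with an explicit constant -/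

/-- **SUPER-EXPONENTIAL BEATS GEOMETRIC**, explicitly: `a > 0`, `r > 0`, `θ > 0` and `(θ²)⁻¹ ≤ r^m` give
`e^{−a·rⁿ} ≤ (m!∕a^m)·(θ²)ⁿ` for EVERY `n` — the hypothesis `hS` of `qla_of_defect_smallForAge` for the threshold `S n = s₀·rⁿ`
(`a = δ·s₀`), with a constant independent of `n`. [folklore] -/
theorem exp_neg_mul_pow_le_geometric {a r θ : ℝ} {m : ℕ} (ha : 0 < a) (hr : 0 < r) (hθ : 0 < θ) (hm : (θ ^ 2)⁻¹ ≤ r ^ m)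
    (n : ℕ) : Real.exp (-(a * r ^ n)) ≤ (m ! : ℝ) / a ^ m * (θ ^ 2) ^ n := by
  have hrn : 0 < r ^ n := pow_pos hr n
  have hx : 0 < a * r ^ n := mul_pos ha hrn
  have hθ2 : 0 < θ ^ 2 := pow_pos hθ 2
  -- `e^{−x} ≤ m!∕x^m` for `x = a·rⁿ > 0`: the reciprocal of Mathlib's `x^m∕m! ≤ eˣ` (the same one-liner is landed as
  -- `Literature.Computability.Complexity.GoldwasserSipser.exp_neg_le_factorial_div_pow`; not imported into this QFT file)
  have h1 : Real.exp (-(a * r ^ n)) ≤ (m ! : ℝ) / (a * r ^ n) ^ m := by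
    have h := Real.pow_div_factorial_le_exp (a * r ^ n) hx.le m
    have hpos : 0 < (a * r ^ n) ^ m / (m ! : ℝ) := by positivity
    rw [Real.exp_neg, ← inv_div]
    exact inv_anti₀ hpos h
  have h2 : (m ! : ℝ) / (a * r ^ n) ^ m = (m ! : ℝ) / a ^ m * ((r ^ m) ^ n)⁻¹ := by
    rw [mul_pow, ← pow_mul, ← pow_mul, mul_comm n m, div_mul_eq_div_div, div_eq_mul_inv ((m ! : ℝ) / a ^ m)]
  have h3 : ((r ^ m) ^ n)⁻¹ ≤ (θ ^ 2) ^ n := by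
    rw [← inv_pow]
    exact pow_le_pow_left₀ (inv_nonneg.mpr (pow_nonneg hr.le m)) (inv_le_of_inv_le₀ hθ2 hm) n
  calc Real.exp (-(a * r ^ n)) ≤ (m ! : ℝ) / (a * r ^ n) ^ m := h1
    _ = (m ! : ℝ) / a ^ m * ((r ^ m) ^ n)⁻¹ := h2
    _ ≤ (m ! : ℝ) / a ^ m * (θ ^ 2) ^ n := mul_le_mul_of_nonneg_left h3 (by positivity)

/-- For `r > 1` an exponent `m` with `(θ²)⁻¹ ≤ r^m` exists (Archimedes); in d = 4 with `θ = L^{1−d}` and `r = L`: `m = 2d − 2 = 6`.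
[folklore] -/
theorem exists_pow_ge_inv_sq {r : ℝ} (θ : ℝ) (hr : 1 < r) : ∃ m : ℕ, (θ ^ 2)⁻¹ ≤ r ^ m :=
  (pow_unbounded_of_one_lt _ hr).imp fun _ h => h.le

/-- The geometric threshold `S n = s₀·rⁿ` packaged as the hypothesis `hS` of `qla_of_defect_smallForAge` (all `n`, hence all
`n ≤ K`, uniformly in `K`). [folklore] -/
theorem threshold_geometric {δ s₀ r θ : ℝ} {m : ℕ} (hδ : 0 < δ) (hs₀ : 0 < s₀) (hr : 0 < r) (hθ : 0 < θ)
    (hm : (θ ^ 2)⁻¹ ≤ r ^ m) (K : ℕ) :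
    ∀ n ≤ K, Real.exp (-(δ * (s₀ * r ^ n))) ≤ (m ! : ℝ) / (δ * s₀) ^ m * (θ ^ 2) ^ n := by
  intro n _
  rw [← mul_assoc]
  exact exp_neg_mul_pow_le_geometric (mul_pos hδ hs₀) hr hθ hm n

/-! ## §3 The tilted census in the PRINTED format on the cell's tori (file 44 with `κ − δ` in place of `κ`) -/

variable {P : Params}

/-- **THE `δ`-TILTED LEDGER CENSUS FROM THE PRINTED DECAY FORMAT.**  As in file 44's `multiplicity_of_torusTreeDecay_sites`
(scale-`j` cells = sites of `T^{(j)}`, every entry's cell family a torus localization domain, injective per scale,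
`0 ≤ w ≤ E₀·e^{−κ·d_j}`) but with `κ ≥ κ₀(4·2^d, 2d) + δ`, `δ ≥ 0`: the tilted weights `w·e^{δ·d_j}` are `≤ E₀·e^{−(κ−δ)·d_j}` with
`κ − δ ≥ κ₀`, hence obey the SAME census `Multiplicity fac sc (w·e^{δ d}) (E₀·K₀(4·2^d, 2d)) |T^{(K)}| (L^d) K` (room `δ > 0` exists iff
`κ > κ₀` strictly — a numerical question about print's constants, not settled here). [folklore] -/
theorem multiplicity_tilted_of_torusTreeDecay_sites (fac : Finset D) (sc : D → ℕ)
    (cells : (j : ℕ) → D → Finset (Site P j)) (w : D → ℝ) {E₀ κ δ : ℝ} (hE : 0 ≤ E₀)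
    (hκ : kappa₀ (4 * 2 ^ P.d) (2 * P.d) + δ ≤ κ)
    (hdom : ∀ i ∈ fac, (cells (sc i) i).Nonempty ∧ TFaceConnected (cells (sc i) i))
    (hinj : ∀ j, Set.InjOn (cells j) ↑(fac.filter fun i => sc i = j)) (hw0 : ∀ i ∈ fac, 0 ≤ w i)
    (hw : ∀ i ∈ fac, w i ≤ E₀ * Real.exp (-κ * torusTreeLen (cells (sc i) i))) :
    Multiplicity fac sc (fun i => w i * Real.exp (δ * torusTreeLen (cells (sc i) i))) (E₀ * K₀ (4 * 2 ^ P.d) (2 * P.d))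
      (Fintype.card (Site P P.K)) ((P.L : ℝ) ^ P.d) P.K := by
  refine multiplicity_of_torusTreeDecay_sites fac sc cells _ hE (κ := κ - δ) (by linarith) hdom hinj
    (fun i hi => mul_nonneg (hw0 i hi) (Real.exp_nonneg _)) fun i hi => ?_
  calc w i * Real.exp (δ * torusTreeLen (cells (sc i) i))
      ≤ E₀ * Real.exp (-κ * torusTreeLen (cells (sc i) i)) * Real.exp (δ * torusTreeLen (cells (sc i) i)) :=
        mul_le_mul_of_nonneg_right (hw i hi) (Real.exp_nonneg _)
    _ = E₀ * Real.exp (-(κ - δ) * torusTreeLen (cells (sc i) i)) := by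
        rw [mul_assoc, ← Real.exp_add]
        ring_nf

/-! ## §4 END corollary on the cell's tori: the size is the tree length `d_j`, the threshold geometric -/

/-- **(QL-a) ON THE CELL'S TORI WITH NODE S SILENT ON THE DOMAINS THAT ARE LARGE FOR THEIR AGE.**  Ledger in the printed format
(file 44: cells of `T^{(j)}`, localization domains, injective per scale, `0 ≤ wt ≤ E₀·e^{−κ·d_j}`) with `κ ≥ κ₀(4·2^d, 2d) + δ`,
`δ > 0`; per entry the weight-carrying trivial bound, and the contracting bound `2|t|·Cd·wt·(θ^{K − sc})²` for the entries whose tree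
length is small for their age, `d_j(X) ≤ s₀·r^{K − sc X}` (`s₀ > 0`, `r > 0`, `(θ²)⁻¹ ≤ r^m`).  Then
`Spine.NE7.QLa wf sc ct c0 K |T^{(K)}| (2l₀·Cd·E₀K₀ + 4l₀·E₀K₀·m!∕(δs₀)^m) (θ²·L^d)` (`K = P.K`, `K₀ = K₀(4·2^d, 2d)`).  The constant
does not depend on `K` or on the entries; with `r = L`, `θ = L^{1−d}`: `m = 2d − 2`. [folklore] -/
theorem qla_of_defect_smallForAge_torus {wf : Finset D} {sc : D → ℕ} {wt ct c0 : D → ℝ} {l₀ Cd θ t E₀ κ δ s₀ r : ℝ} {m : ℕ}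
    (ht : |t| ≤ l₀) (hCd : 0 ≤ Cd) (hwt : ∀ X ∈ wf, 0 ≤ wt X) (hθ : 0 < θ) (hδ : 0 < δ) (hs₀ : 0 < s₀) (hr : 0 < r)
    (hm : (θ ^ 2)⁻¹ ≤ r ^ m)
    (cells : (j : ℕ) → D → Finset (Site P j)) (hE : 0 ≤ E₀) (hκ : kappa₀ (4 * 2 ^ P.d) (2 * P.d) + δ ≤ κ)
    (hdom : ∀ X ∈ wf, (cells (sc X) X).Nonempty ∧ TFaceConnected (cells (sc X) X))
    (hinj : ∀ j, Set.InjOn (cells j) ↑(wf.filter fun X => sc X = j))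
    (hw : ∀ X ∈ wf, wt X ≤ E₀ * Real.exp (-κ * torusTreeLen (cells (sc X) X)))
    (htriv : ∀ X ∈ wf, |ct X - c0 X| ≤ 4 * |t| * wt X)
    (hdef : ∀ X ∈ wf, torusTreeLen (cells (sc X) X) ≤ s₀ * r ^ (P.K - sc X) →
      |ct X - c0 X| ≤ 2 * (|t| * (Cd * wt X * (θ ^ (P.K - sc X)) ^ 2))) :
    QLa wf sc ct c0 P.K (Fintype.card (Site P P.K))
      (2 * l₀ * Cd * (E₀ * K₀ (4 * 2 ^ P.d) (2 * P.d))
        + 4 * l₀ * (E₀ * K₀ (4 * 2 ^ P.d) (2 * P.d)) * ((m ! : ℝ) / (δ * s₀) ^ m))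
      (θ ^ 2 * (P.L : ℝ) ^ P.d) := by
  have hκ' : kappa₀ (4 * 2 ^ P.d) (2 * P.d) ≤ κ := by linarith
  exact qla_of_defect_smallForAge (sz := fun X => torusTreeLen (cells (sc X) X)) (fun n => s₀ * r ^ n) ht hCd hwt hδ.le
    (Nat.cast_nonneg _) (pow_nonneg (Nat.cast_nonneg _) _) (mul_nonneg hE (K₀_pos _ _).le) htriv hdef
    (multiplicity_of_torusTreeDecay_sites wf sc cells wt hE hκ' hdom hinj hwt hw)
    (multiplicity_tilted_of_torusTreeDecay_sites wf sc cells wt hE hκ hdom hinj hwt hw)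
    (threshold_geometric hδ hs₀ hr hθ hm P.K)

end Summit.QuantumFields.BalabanUV.T4Continuum.Spine.NE7

end
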